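import Literature.Computability.AlgebraicComplexity.ArithCircuitProjections
import Literature.Computability.AlgebraicComplexity.LowDepthRankBoundLargeChar
import Literature.Computability.AlgebraicComplexity.AndrewsForbes2022Applications
import Literature.Computability.Complexity.ConstantDepthIMMProofs
import HarnessLib

/-!
# Andrews–Forbes 2022, §6.1: the Limaye–Srinivasan–Tavenas lower bound is robust to border
# complexity (Lemmas 6.1–6.4, Corollary 6.5) — PROVED; discharge of `AndrewsForbes2022_cor_6_5`

Source: R. Andrews, M. A. Forbes, *Ideals, determinants, and straightening: proving and using lower
bounds for polynomial ideals*, STOC 2022 = arXiv:2112.00792 [`AndrewsForbes2022`], §6.1 "Making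
[LST21a] robust" (p0032–p0033 of `lit read paper:arxiv-2112.00792`): "the lower bound of [LST21a]
extends to the border of low-depth circuits. This essentially follows from the fact that they use a
rank-based measure" (p0032:L22–L23). Companion of the statement file
`AndrewsForbes2022Applications.lean` (val-lit t24), whose named fact `AndrewsForbes2022_cor_6_5`
(both bullets: `char F = 0`, and `char F = p > d`) this file DISCHARGES:
`AndrewsForbes2022_cor_6_5_holds`.

## The proof (how the printed §6.1 maps onto the tree)

The tree holds a complete proof of [LST21a] = LST, J. ACM 72 (2025), Cor. 4
(`Literature.Computability.Complexity.ConstantDepthIMMProofs`: the engine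
`LSTWord.relRank_aeval_eval_le` of `LowDepthRankBound.lean` — Claim 16 + Prop. 9 run on the gate
values of an arbitrary circuit `P` over a field `K` after a block-preserving substitution `g` —,
the full-rank computation `LSTWord.relRank_wordPoly_ge` (`WordPolynomialRank.lean`), the word
projection `LSTWord.aeval_wordSubst_immPoly` (`WordAutomaton.lean`) and the final arithmetic
`LSTWord.final_arith`; large-characteristic form of the engine: `LSTWord.relRank_aeval_eval_le'`,
`LowDepthRankBoundLargeChar.lean`). The printed Lemmas 6.1–6.4 re-run [LST21a]'s two steps
"`+ O(ε)`"; here this is literally ONE run of the engine over the FIELD `K = F((ε))`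
(`LaurentSeries F`; `1, …, d` stay invertible in it) on the border circuit, plus:

* **Lemma 6.2's sentence** "since `P_w` can be obtained as a projection of `P_w + O(ε)` by setting
  `ε = 0`, the lower bound on relative rank extends to `P_w + O(ε)`" (p0032:L58) =
  `BorderLST.relRank_le_of_polyOrdGE`: for `f ∈ F[X]` and `h ∈ F((ε))[X]` with `h - f = O(ε)`
  coefficientwise (`PolyOrdGE 1`), `relRank_F(f) ≤ relRank_{F((ε))}(h)` — an `F`-independent family
  of rows of the coefficient matrix stays `F((ε))`-independent after an `O(ε)` perturbation
  (`BorderLST.linearIndependent_of_isOrdGE`: scale a dependency to order `0` and read off the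
  `ε⁰`-coefficients);
* the `(1,1)`-ENTRY form of `IMM_{n,d}` (AF22 and LST use the entry, the tree's `immPoly` is the
  trace): under the word substitution both project to `P_w`
  (`LSTWord.aeval_wordSubst_immMatrix_zero`, via `LayeredAutomaton.aeval_autSubst_immMatrix_src`:
  the last layer matrix has the single nonzero column `src = 0`, so the trace is the `(0,0)` entry);
* the substitution has coefficients in `F` (`LSTWord.map_wordSubst`), so it maps `O(ε)` errors to
  `O(ε)` errors (`PolyOrdGE.bind₁`), and `ρ(h) = P_w + O(ε)`;
* WIRES versus GATES: the §6 class of record (`productDepthEdgeClass`, size = `edgeSize`) is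
  bridged to the engine's gate count by empty-gate pruning
  (`ArithCircuit.exists_size_le_edgeSize`, `ArithCircuitProjections.lean`);
* the printed range `d ≤ (log n)/100` versus the engine's `d ≤ ε(Δ) log n`: truncate `IMM_{n,d}` to
  `IMM_{n,d'}`, `d' = ⌊ε log n⌋`, inside the border class (`BorderLST.immMatrix_mem_borderClass_of_le`,
  by the variable-to-constant projection `ArithCircuit.substVC` / `immTrunc`), costing a factor `2`
  in the exponent `δ`;
* `char F = 0` or `> d` ⇒ `1, …, d` invertible in `F` (`BorderLST.natCast_ne_zero_of_ringChar`),
  hence in `F((ε))`.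

## Main statements

* `AndrewsForbes2022_cor_6_5_engine` — engine range `d₀ ≤ d ≤ ε log n`, constants `δ, ε, d₀`
  depending on `Δ` only, any field with `1, …, d` invertible;
* `AndrewsForbes2022_cor_6_5_explicit` — printed range `d₀ ≤ d ≤ (log n)/100`, `char F = 0` or
  `> d`, constants depending on `Δ` only (the F-uniform form that Lemma 6.6's universal constant
  needs);
* `AndrewsForbes2022_cor_6_5_holds : AndrewsForbes2022_cor_6_5` — the discharge;
* `AndrewsForbes2022_cor_6_5_engine_mu` / `_explicit_mu` — the same with the exponent made
  explicit, `δ = μ_Δ/2` resp. `μ_Δ/4` (`μ_Δ ≥ 7^{-Δ}`, `BorderLST.pow_inv_seven_le_mu`;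
  `BorderLST.final_arith_mu` is `LSTWord.final_arith` with the exponent named), appended for
  Lemma 6.6's universal constant `c` in `exp(-cΔ)`.

Not done here: Lemmas 6.6, 6.7 (via Cor. 3.10 and Lemma 2.10, both theorems of the tree) — next.

Honest framing: a border-complexity version of a PROVED lower bound ([LST21]) re-run in the kernel;
VP ≠ VNP is NOT proved and nothing here is progress on it.

## References

* [AndrewsForbes2022] R. Andrews, M. A. Forbes, STOC 2022, arXiv:2112.00792, §6.1, Lemmas 6.1–6.4,
  Cor. 6.5 (p0032:L20–p0033:L21).
* [LimayeSrinivasanTavenas2025] N. Limaye, S. Srinivasan, S. Tavenas, J. ACM 72 (2025), Art. 26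
  (= FOCS 2021), Cor. 4, Lemma 8, Claim 16, Lemma 22.
-/

noncomputable section

/-! ## Rank under the specialisation `ε → 0` (Lemma 6.2) -/

open MvPolynomial Module Submodule

namespace Literature.Computability.AlgebraicComplexity

namespace BorderLST

universe u

variable {F : Type u} [Field F]

/-- The `ε⁰`-coefficient of `x · (a + e)` for `x = O(1)`, `e = O(ε)`, `a ∈ F`: it is `x₀ · a`.
[cite: AndrewsForbes2022, Lemma 6.2] -/
theorem coeff_zero_mul_of_isOrdGE {x y : LaurentSeries F} {a : F} (hx : IsOrdGE 0 x)
    (hy : IsOrdGE 1 (y - algebraMap F (LaurentSeries F) a)) :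
    (x * y).coeff 0 = x.coeff 0 * a := by
  have hsplit : y = HahnSeries.C a + (y - algebraMap F (LaurentSeries F) a) := by
    rw [algebraMap_laurentSeries_apply]; ring
  rw [hsplit, mul_add, HahnSeries.coeff_add]
  have h1 : (x * (y - algebraMap F (LaurentSeries F) a)).coeff 0 = 0 := by
    have := hx.mul hy
    exact this 0 (by norm_num)
  rw [h1, add_zero, mul_comm x, HahnSeries.C_mul_eq_smul, HahnSeries.coeff_smul, smul_eq_mul,
    mul_comm]

/-- Shifting a Laurent series down by its order makes it `O(1)` with nonzero `ε⁰`-coefficient;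
shifting any series of order `≥ v` down by `v` makes it `O(1)`. [cite: AndrewsForbes2022, Lemma 6.2] -/
theorem isOrdGE_zero_single_neg_mul {x : LaurentSeries F} {v : ℤ} (hv : x = 0 ∨ v ≤ x.order) :
    IsOrdGE 0 (HahnSeries.single (-v) (1 : F) * x) := by
  intro i hi
  rw [HahnSeries.coeff_single_mul, one_mul, sub_neg_eq_add]
  rcases hv with rfl | hv
  · simp
  · exact HahnSeries.coeff_eq_zero_of_lt_order (by omega)

/-- Shifting a nonzero Laurent series down by its order gives a nonzero `ε⁰`-coefficient.
[cite: AndrewsForbes2022, Lemma 6.2] -/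
theorem coeff_zero_single_neg_order_mul {x : LaurentSeries F} (hx : x ≠ 0) :
    (HahnSeries.single (-x.order) (1 : F) * x).coeff 0 ≠ 0 := by
  rw [HahnSeries.coeff_single_mul, one_mul, sub_neg_eq_add, zero_add]
  rwa [Ne, HahnSeries.coeff_order_eq_zero]

/-- **Linear independence survives an `O(ε)` perturbation** (the linear algebra behind AF22's
Lemma 6.2): if the rows `M r ∈ F^C` are linearly independent over `F` and `M' r ∈ F((ε))^C`
satisfies `M' r c = M r c + O(ε)`, then the rows `M' r` are linearly independent over `F((ε))`.
Proof: scale a dependency so that its coefficients are `O(1)` with one nonzero `ε⁰`-coefficient and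
read off the `ε⁰`-coefficients. [cite: AndrewsForbes2022, Lemma 6.2] -/
theorem linearIndependent_of_isOrdGE {R : Type*} {C : Type*} [Fintype R]
    (M : R → C → F) (M' : R → C → LaurentSeries F)
    (hM : ∀ r c, IsOrdGE 1 (M' r c - algebraMap F (LaurentSeries F) (M r c)))
    (hli : LinearIndependent F M) : LinearIndependent (LaurentSeries F) M' := by
  classical
  rw [Fintype.linearIndependent_iff] at hli ⊢
  intro g hg
  by_contra hne
  push Not at hne
  obtain ⟨r₁, hr₁⟩ := hne
  -- a nonzero coefficient of least order
  obtain ⟨r₀, hr₀mem, hmin⟩ := (Finset.univ.filter fun r => g r ≠ 0).exists_min_image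
    (fun r => (g r).order) ⟨r₁, by simpa using hr₁⟩
  have hr₀ : g r₀ ≠ 0 := by simpa using hr₀mem
  set v : ℤ := (g r₀).order with hv
  set g' : R → LaurentSeries F := fun r => HahnSeries.single (-v) (1 : F) * g r with hg'
  have hg'0 : ∀ r, IsOrdGE 0 (g' r) := by
    intro r
    refine isOrdGE_zero_single_neg_mul ?_
    by_cases h : g r = 0
    · exact Or.inl h
    · exact Or.inr (hmin r (by simpa using h))
  have h00 : (g' r₀).coeff 0 ≠ 0 := coeff_zero_single_neg_order_mul hr₀
  -- the `ε⁰`-coefficients give an `F`-relation among the rows `M r`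
  have hrel : ∑ r, (fun r => (g' r).coeff 0) r • M r = 0 := by
    funext c
    have hc := congr_arg (fun f : C → LaurentSeries F => (HahnSeries.single (-v) (1 : F) * f c).coeff 0) hg
    simp only [Finset.sum_apply, Pi.smul_apply, smul_eq_mul, Pi.zero_apply, mul_zero,
      HahnSeries.coeff_zero, Finset.mul_sum] at hc
    rw [HahnSeries.coeff_sum] at hc
    simp only [Finset.sum_apply, Pi.smul_apply, smul_eq_mul, Pi.zero_apply]
    rw [← hc]
    refine Finset.sum_congr rfl fun r _ => ?_
    rw [← mul_assoc]
    exact (coeff_zero_mul_of_isOrdGE (hg'0 r) (hM r c)).symm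
  exact h00 (hli _ hrel r₀)

/-- **Rank does not drop under an `O(ε)` perturbation**: `finrank_F (span (rows of M)) ≤
finrank_{F((ε))} (span (rows of M'))` when `M' = M + O(ε)` entrywise. [cite: AndrewsForbes2022, Lemma 6.2] -/
theorem finrank_span_le_of_isOrdGE {R : Type*} {C : Type*} [Fintype R] [Fintype C]
    (M : R → C → F) (M' : R → C → LaurentSeries F)
    (hM : ∀ r c, IsOrdGE 1 (M' r c - algebraMap F (LaurentSeries F) (M r c))) :
    finrank F (span F (Set.range M)) ≤ finrank (LaurentSeries F) (span (LaurentSeries F) (Set.range M')) := by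
  classical
  obtain ⟨κ, a, ha, hspan, hli⟩ := exists_linearIndependent' F M
  have hfin : Finite κ := by
    haveI : Fintype R := inferInstance
    exact Finite.of_injective a ha
  haveI : Fintype κ := Fintype.ofFinite κ
  have hli' : LinearIndependent (LaurentSeries F) (M' ∘ a) :=
    linearIndependent_of_isOrdGE (M ∘ a) (M' ∘ a) (fun r c => hM (a r) c) hli
  calc finrank F (span F (Set.range M)) = finrank F (span F (Set.range (M ∘ a))) := by rw [hspan]
    _ = Fintype.card κ := finrank_span_eq_card hli
    _ = finrank (LaurentSeries F) (span (LaurentSeries F) (Set.range (M' ∘ a))) :=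
        (finrank_span_eq_card hli').symm
    _ ≤ finrank (LaurentSeries F) (span (LaurentSeries F) (Set.range M')) := by
        refine Submodule.finrank_mono (span_mono ?_)
        rintro _ ⟨i, rfl⟩
        exact ⟨a i, rfl⟩

/-! ### Relative rank under specialisation -/

variable {ι : Type} {X : ι → Type} [∀ i, Fintype (X i)] [DecidableEq ι]

/-- `rank M(f) ≤ rank M(h)` for `h = f + O(ε)` (ranks over `F` and over `F((ε))` respectively).
[cite: AndrewsForbes2022, Lemma 6.2] -/
theorem pdRank_le_of_polyOrdGE (A B : Finset ι) (f : MvPolynomial (Σ i, X i) F)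
    (h : MvPolynomial (Σ i, X i) (LaurentSeries F))
    (hh : PolyOrdGE 1 (h - MvPolynomial.map (algebraMap F (LaurentSeries F)) f)) :
    pdRank F A B f ≤ pdRank (LaurentSeries F) A B h := by
  classical
  unfold pdRank
  refine finrank_span_le_of_isOrdGE (coeffMat F A B f) (coeffMat (LaurentSeries F) A B h) ?_
  intro r c
  simp only [coeffMat_apply]
  have := hh (assignMonomial A r + assignMonomial B c)
  rwa [coeff_sub, coeff_map] at this

/-- `relrk(f) ≤ relrk(h)` for `h = f + O(ε)`, explicit row/column blocks.
[cite: AndrewsForbes2022, Lemma 6.2] -/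
theorem relRankPair_le_of_polyOrdGE (A B : Finset ι) (f : MvPolynomial (Σ i, X i) F)
    (h : MvPolynomial (Σ i, X i) (LaurentSeries F))
    (hh : PolyOrdGE 1 (h - MvPolynomial.map (algebraMap F (LaurentSeries F)) f)) :
    relRankPair F A B f ≤ relRankPair (LaurentSeries F) A B h := by
  unfold relRankPair
  exact div_le_div_of_nonneg_right (by exact_mod_cast pdRank_le_of_polyOrdGE A B f h hh)
    (Real.sqrt_nonneg _)

/-- **AF22 Lemma 6.2, the rank step**: `relrk_w(f) ≤ relrk_w(f + O(ε))` — the relative rank over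
`F` of a polynomial `f ∈ F[X]` is at most the relative rank over `F((ε))` of any `h ∈ F((ε))[X]`
with `h - f = O(ε)` ("`P_w` can be obtained as a projection of `P_w + O(ε)` by setting `ε = 0`",
p0032:L58). [cite: AndrewsForbes2022, Lemma 6.2] -/
theorem relRank_le_of_polyOrdGE (pos : ι → Bool) (S : Finset ι) (f : MvPolynomial (Σ i, X i) F)
    (h : MvPolynomial (Σ i, X i) (LaurentSeries F))
    (hh : PolyOrdGE 1 (h - MvPolynomial.map (algebraMap F (LaurentSeries F)) f)) :
    relRank F pos S f ≤ relRank (LaurentSeries F) pos S h :=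
  relRankPair_le_of_polyOrdGE _ _ f h hh

end BorderLST

end Literature.Computability.AlgebraicComplexity

/-! ## The `(1,1)`-entry form of the word projection; base change -/

open MvPolynomial Matrix

namespace Literature.Computability.AlgebraicComplexity

namespace LayeredAutomaton

universe u

section Entry

variable {K : Type u} [CommSemiring K]
variable {d n : ℕ} {St : ℕ → Type} [∀ t, Fintype (St t)]
variable {In : Fin d → Type} [∀ t, Fintype (In t)] [∀ t, DecidableEq (In t)]
  [∀ t, Inhabited (In t)]
variable (start : St 0) (step : (t : Fin d) → St t → In t → Option (St (t.val + 1)))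
variable (enc : (t : ℕ) → St t → Fin n)

variable (henc : ∀ t, t ≤ d → Function.Injective (enc t))
include henc

omit [∀ t, DecidableEq (In t)] [∀ t, Inhabited (In t)] henc in
/-- The diagonal of the full product `A_0 ⋯ A_{d-1}` vanishes off the column `src` (the last layer
matrix has the single nonzero column `src`), so its trace is its `(src, src)` entry.
[cite: LimayeSrinivasanTavenas2025, Lemma 22] -/
theorem prefixProd_apply_src_src_eq_trace (hd : 0 < d) :
    prefixProd (K := K) start step enc d (src start enc) (src start enc) =
      Matrix.trace (prefixProd (K := K) start step enc d) := by
  classical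
  have hd'lt : d - 1 < d := Nat.sub_lt hd Nat.one_pos
  have hlast : prefixProd (K := K) start step enc d =
      prefixProd (K := K) start step enc (d - 1) * layerMat (K := K) start step enc (d - 1) := by
    unfold prefixProd
    rw [range_eq_range_pred_append hd, List.map_append, List.map_singleton, List.prod_append,
      List.prod_singleton]
  rw [Matrix.trace]
  simp only [Matrix.diag_apply]
  rw [Finset.sum_eq_single (src start enc)]
  · intro i _ hi
    rw [hlast, Matrix.mul_apply]
    refine Finset.sum_eq_zero fun e _ => ?_
    rw [layerMat_last_apply_of_ne (K := K) start step enc hd hi, mul_zero]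
  · intro h; exact absurd (Finset.mem_univ _) h

/-- **Entry form of the projection**: substituting `autSubst` into the `(src, src)` ENTRY of
`X^{(0)} ⋯ X^{(d-1)}` (rather than its trace) also yields the sum over the accepted words — LST's
`IMM_{n,d}` is the `(1,1)` entry; the tree's `immPoly` is the trace; under the automaton
substitution the two coincide. [cite: LimayeSrinivasanTavenas2025, Lemma 8] -/
theorem aeval_autSubst_immMatrix_src (hd : 0 < d) :
    aeval (autSubst (K := K) start step enc) (immMatrix (Fin n) d K (src start enc) (src start enc)) =
      ∑ w : (t : Fin d) → In t, if Accepts start step w then ∏ t : Fin d, X ⟨t, w t⟩ else 0 := by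
  rw [← aeval_autSubst_immPoly (K := K) start step enc henc hd, aeval_immMatrix_apply,
    finRange_map_prod_eq_prefixProd, prefixProd_apply_src_src_eq_trace (K := K) start step enc hd,
    aeval_immPoly_eq_trace, finRange_map_prod_eq_prefixProd]

end Entry

end LayeredAutomaton

namespace LSTWord

variable {d : ℕ} (k : ℕ) (pos : Fin d → Bool) (K : Type*) [CommSemiring K]
variable {n : ℕ} (hn : ∀ t ≤ d, 2 ^ overLen k pos t ≤ n)

/-- The start state of the queue automaton is encoded by `0 ∈ Fin n`. [cite: LimayeSrinivasanTavenas2025, Lemma 8] -/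
theorem src_wordEnc_val :
    (LayeredAutomaton.src (St := fun t => List.Vector Bool (overLen k pos t))
      (wordStart k pos) (wordEnc k pos hn) : ℕ) = 0 := by
  unfold LayeredAutomaton.src wordEnc
  rw [dif_pos (Nat.zero_le d), Fin.val_castLE]
  exact Fin.val_eq_zero _

/-- **`P_w` is a projection of the `(0,0)` entry `(X^{(0)} ⋯ X^{(d-1)})_{0 0}`** (the `(1,1)`-entry
form of `IMM_{n,d}` used by LST 2025 and by Andrews–Forbes 2022, Cor. 6.5), under the same
block-preserving substitution `wordSubst` as for the trace form. [cite: LimayeSrinivasanTavenas2025, Lemma 8] -/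
theorem aeval_wordSubst_immMatrix_zero [NeZero n] (hd : 0 < d) :
    aeval (wordSubst k pos K hn) (immMatrix (Fin n) d K 0 0) = wordPoly k pos K := by
  have h0 : (0 : Fin n) = LayeredAutomaton.src (St := fun t => List.Vector Bool (overLen k pos t))
      (wordStart k pos) (wordEnc k pos hn) :=
    Fin.ext (by rw [src_wordEnc_val, Fin.val_zero])
  rw [h0]
  unfold wordSubst wordPoly
  rw [LayeredAutomaton.aeval_autSubst_immMatrix_src _ _ _ (wordEnc_injective k pos hn) hd]
  refine Finset.sum_congr rfl fun w _ => ?_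
  simp only [accepts_wordStep_iff]

/-! ### Base change of the word substitution and of `IMM` -/

/-- `wordSubst` has coefficients `0, 1`: it commutes with any change of scalars. [cite: LimayeSrinivasanTavenas2025, Lemma 8] -/
theorem map_wordSubst {L : Type*} [CommSemiring L] (φ : K →+* L) (v : Fin d × Fin n × Fin n) :
    MvPolynomial.map φ (wordSubst k pos K hn v) = wordSubst k pos L hn v := by
  unfold wordSubst LayeredAutomaton.autSubst
  rw [map_sum]
  refine Finset.sum_congr rfl fun b _ => ?_
  split_ifs <;> simp

/-- `wordPoly` has coefficients `0, 1`: it commutes with any change of scalars. [cite: LimayeSrinivasanTavenas2025, Lemma 8] -/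
theorem map_wordPoly {L : Type*} [CommSemiring L] (φ : K →+* L) :
    MvPolynomial.map φ (wordPoly k pos K) = wordPoly k pos L := by
  unfold wordPoly
  rw [map_sum]
  refine Finset.sum_congr rfl fun w _ => ?_
  split_ifs <;> simp [map_prod]

end LSTWord

/-- The generic matrix product `X^{(0)} ⋯ X^{(d-1)}` commutes with any change of scalars.
[cite: LimayeSrinivasanTavenas2025, Lemma 8] -/
theorem map_immMatrix_apply {K L : Type*} [CommSemiring K] [CommSemiring L] (φ : K →+* L)
    {n : Type*} [Fintype n] [DecidableEq n] (d : ℕ) (i j : n) :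
    MvPolynomial.map φ (immMatrix n d K i j) = immMatrix n d L i j := by
  unfold immMatrix
  have h : MvPolynomial.map φ ((((List.finRange d).map fun t =>
      (Matrix.mvPolynomialX n n K).map (rename fun ij : n × n => (t, ij))).prod) i j) =
      ((MvPolynomial.map φ).mapMatrix (((List.finRange d).map fun t =>
      (Matrix.mvPolynomialX n n K).map (rename fun ij : n × n => (t, ij))).prod)) i j := by
    rw [RingHom.mapMatrix_apply, Matrix.map_apply]
  rw [h, map_list_prod, List.map_map]
  have hl : ((List.finRange d).map ((MvPolynomial.map φ).mapMatrix ∘ fun t =>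
      (Matrix.mvPolynomialX n n K).map (rename fun ij : n × n => (t, ij)))) =
      (List.finRange d).map fun t =>
        (Matrix.mvPolynomialX n n L).map (rename fun ij : n × n => (t, ij)) := by
    refine List.map_congr_left fun t _ => ?_
    ext i j
    simp [Matrix.map_apply, Matrix.mvPolynomialX_apply]
  rw [hl]

end Literature.Computability.AlgebraicComplexity

/-! ## Assembly: Cor. 6.5 -/

namespace Literature.Computability.AlgebraicComplexity

open MvPolynomial ArithCircuit LSTWord BorderLST Real

universe u

/-- `1, …, d` are invertible in a field of characteristic `0` or `> d`. (`ringChar.spec`)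
[cite: AndrewsForbes2022, Cor. 6.5 (hypothesis "`ch(F) = 0` or `ch(F) > d`")] -/
theorem BorderLST.natCast_ne_zero_of_ringChar {F : Type u} [Field F] {d : ℕ}
    (h : ringChar F = 0 ∨ d < ringChar F) {i : ℕ} (hi : 0 < i) (hid : i ≤ d) : (i : F) ≠ 0 := by
  intro h0
  rw [ringChar.spec F i] at h0
  rcases h with h | h
  · rw [h, zero_dvd_iff] at h0; omega
  · exact absurd (Nat.le_of_dvd hi h0) (by omega)

/-- **Truncation inside the border class**: if `(X^{(0)} ⋯ X^{(d-1)})_{00} + O(ε)` is computed by a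
product-depth-`Δ` circuit with `s` wires over `F((ε))`, then so is `(X^{(0)} ⋯ X^{(d'-1)})_{00} + O(ε)`
for every `d' ≤ d` (substitute the identity matrix for `X^{(t)}`, `t ≥ d'`: a variable-to-constant
projection keeps wires and product-depth). [cite: AndrewsForbes2022, Cor. 6.5] -/
theorem BorderLST.immMatrix_mem_borderClass_of_le {F : Type} [Field F] {n d d' s Δ : ℕ}
    (hd : d' ≤ d) (i j : Fin n)
    (hmem : immMatrix (Fin n) d F i j ∈
      borderClass F (productDepthEdgeClass (LaurentSeries F) (Fin d × Fin n × Fin n) s Δ)) :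
    immMatrix (Fin n) d' F i j ∈
      borderClass F (productDepthEdgeClass (LaurentSeries F) (Fin d' × Fin n × Fin n) s Δ) := by
  obtain ⟨h, ⟨P, hPh, hPΔ, hPs⟩, hord⟩ := hmem
  obtain ⟨t, ht⟩ : ∃ t : Fin d × Fin n × Fin n → (Fin d' × Fin n × Fin n) ⊕ LaurentSeries F,
      t = fun v => (immTrunc F n d d' v).map id (algebraMap F (LaurentSeries F)) := ⟨_, rfl⟩
  refine ⟨aeval (substVCFun t) h, ⟨P.substVC t, ?_, ?_, ?_⟩, ?_⟩
  · rw [Computes, eval_substVC]; exact congr_arg _ hPh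
  · rw [productDepth_substVC]; exact hPΔ
  · rw [edgeSize_substVC]; exact hPs
  · have hsub : ∀ v, substVCFun t v =
        MvPolynomial.map (algebraMap F (LaurentSeries F)) (Sum.elim X C (immTrunc F n d d' v)) := by
      intro v
      simp only [substVCFun, ht]
      cases immTrunc F n d d' v with
      | inl y => simp
      | inr c => simp
    have hfun : (fun v => MvPolynomial.map (algebraMap F (LaurentSeries F))
        (Sum.elim X C (immTrunc F n d d' v))) = substVCFun t := funext fun v => (hsub v).symm
    have hIMM : MvPolynomial.map (algebraMap F (LaurentSeries F)) (immMatrix (Fin n) d' F i j) =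
        aeval (substVCFun t)
          (MvPolynomial.map (algebraMap F (LaurentSeries F)) (immMatrix (Fin n) d F i j)) := by
      rw [← aeval_immTrunc_immMatrix F hd i j, MvPolynomial.aeval_eq_bind₁,
        MvPolynomial.aeval_eq_bind₁, map_bind₁]
      exact congrFun (congrArg (fun g => ⇑(bind₁ g)) hfun) _
    rw [hIMM, ← map_sub, MvPolynomial.aeval_eq_bind₁]
    refine hord.bind₁ fun v => ?_
    rw [hsub]
    exact PolyOrdGE.map_algebraMap _

/-- **Border-robust LST, engine range** (Andrews–Forbes 2022, Lemmas 6.1–6.4 / Cor. 6.5, in the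
parameter range of the tree's LST engine): for every product-depth `Δ ≥ 1` there are
`δ, ε > 0` and `d₀ ≥ 1` — depending on `Δ` ONLY — such that over every field `F` in which
`1, …, d` are invertible (`char F = 0` or `> d`), for all `n` and `d₀ ≤ d ≤ ε log n`: if `(X^{(0)} ⋯ X^{(d-1)})_{00} + O(ε)` is computed by a
circuit of product-depth `≤ Δ` with `s` wires over `F((ε))`, then `n^{d^δ} ≤ s`. Proof = the LST
engine (`LSTWord.relRank_aeval_eval_le'` — the large-characteristic form of
`LowDepthRankBoundLargeChar.lean` —, `relRank_wordPoly_ge`, `final_arith`) run over the FIELD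
`F((ε))` on the empty-gate-pruned border circuit, with the rank compared over `F` and over `F((ε))`
by `BorderLST.relRank_le_of_polyOrdGE` (Lemma 6.2: "`P_w` can be obtained as a projection of
`P_w + O(ε)` by setting `ε = 0`"). [cite: AndrewsForbes2022, Cor. 6.5] -/
theorem AndrewsForbes2022_cor_6_5_engine {Δ : ℕ} (hΔ : 1 ≤ Δ) :
    ∃ δ : ℝ, 0 < δ ∧ ∃ ε : ℝ, 0 < ε ∧ ∃ d₀ : ℕ, 1 ≤ d₀ ∧
      ∀ (F : Type) [Field F] (n d : ℕ) [NeZero n], d₀ ≤ d →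
      (∀ i : ℕ, 0 < i → i ≤ d → (i : F) ≠ 0) → (d : ℝ) ≤ ε * Real.log n →
      ∀ s : ℕ, immMatrix (Fin n) d F 0 0 ∈
          borderClass F (productDepthEdgeClass (LaurentSeries F) (Fin d × Fin n × Fin n) s Δ) →
        (n : ℝ) ^ ((d : ℝ) ^ δ) ≤ s := by
  obtain ⟨δ, hδ, ε, hε, hε40, d₀, hd₀, H⟩ := final_arith hΔ
  refine ⟨δ, hδ, ε, hε, d₀, hd₀, ?_⟩
  intro F _ n d _ hd hF hdn s hmem
  -- the border circuit, pruned of its empty gates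
  obtain ⟨h, ⟨P, hPh, hPΔ, hPs⟩, hord⟩ := hmem
  -- `1, …, d` are invertible in `F((ε))` as in `F`
  have hK : ∀ i : ℕ, 0 < i → i ≤ d → (i : LaurentSeries F) ≠ 0 := by
    intro i hi hid
    rw [← map_natCast (algebraMap F (LaurentSeries F)) i]
    exact (map_ne_zero_iff _ (algebraMap F (LaurentSeries F)).injective).2 (hF i hi hid)
  obtain ⟨C, hCeval, hCΔ, hCedge, hCsize⟩ := P.exists_size_le_edgeSize
  have hCh : C.eval = h := hCeval.trans hPh
  have hCΔ' : C.productDepth ≤ Δ := hCΔ.trans hPΔ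
  have hCs : C.size ≤ s := hCsize.trans (hCedge.trans hPs)
  have hd1 : 1 ≤ d := hd₀.trans hd
  have hdR : (1 : ℝ) ≤ d := by exact_mod_cast hd1
  -- `log n ≥ d/ε ≥ 40`
  have hlog : (40 : ℝ) ≤ Real.log n := by
    have h1 : (d : ℝ) ≤ (1 / 40) * Real.log n := hdn.trans (by
      by_cases hn : (1 : ℝ) ≤ n
      · exact mul_le_mul_of_nonneg_right hε40 (Real.log_nonneg hn)
      · push Not at hn
        have : Real.log n ≤ 0 := Real.log_nonpos (Nat.cast_nonneg n) hn.le
        nlinarith)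
    linarith
  have hn2R : (2 : ℝ) ≤ n := by
    by_contra h
    push Not at h
    have : Real.log n < Real.log 2 := by
      rcases Nat.eq_zero_or_pos n with hn | hn
      · subst hn; simp; exact Real.log_pos one_lt_two
      · exact Real.log_lt_log (by exact_mod_cast hn) h
    have := Real.log_two_lt_d9
    linarith
  have hn0 : n ≠ 0 := by rintro rfl; simp at hn2R; linarith
  -- `k = ⌊log₂ n⌋`
  set k := Nat.log 2 n with hk
  have h2k : ((2 : ℕ) ^ k : ℕ) ≤ n := Nat.pow_log_le_self 2 hn0
  have hn2k : n < 2 ^ (k + 1) := Nat.lt_pow_succ_log_self one_lt_two n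
  have h2kR : (2 : ℝ) ^ (k : ℝ) ≤ n := by rw [Real.rpow_natCast]; exact_mod_cast h2k
  have hn2kR : (n : ℝ) < (2 : ℝ) ^ ((k : ℝ) + 1) := by
    rw [show (k : ℝ) + 1 = ((k + 1 : ℕ) : ℝ) by push_cast; ring, Real.rpow_natCast]
    exact_mod_cast hn2k
  have hlogk : Real.log n ≤ (k : ℝ) + 1 := by
    have h1 : Real.log n ≤ Real.log ((2 : ℝ) ^ ((k : ℝ) + 1)) :=
      Real.log_le_log (by linarith) hn2kR.le
    rw [Real.log_rpow (by norm_num)] at h1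
    have := Real.log_two_lt_d9
    have hk0 : (0 : ℝ) ≤ (k : ℝ) + 1 := by positivity
    nlinarith
  have hdk : (d : ℝ) ≤ ε * ((k : ℝ) + 1) := hdn.trans (mul_le_mul_of_nonneg_left hlogk hε.le)
  have h10 : 10 * d ≤ k := by
    have : (40 : ℝ) * d ≤ (k : ℝ) + 1 := by nlinarith
    have : 40 * d ≤ k + 1 := by exact_mod_cast this
    omega
  have hk1 : 1 ≤ k := le_trans (by omega) h10
  -- the greedy `k`-unbiased word and the word substitution, over `K = F((ε))`
  set pos := greedyWord d k with hpos
  have hover : ∀ t, t ≤ d → overLen k pos t ≤ k := by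
    intro t ht
    rw [overLen_eq_natAbs k pos t ht]
    have h := abs_prefixSum_greedyWord_le d k t ht
    rw [← hpos, abs_le] at h
    omega
  have hn' : ∀ t, t ≤ d → 2 ^ overLen k pos t ≤ n := fun t ht =>
    (Nat.pow_le_pow_right Nat.two_pos (hover t ht)).trans h2k
  have hg := isBlockPreserving_wordSubst k pos (LaurentSeries F) hn'
  have hup := relRank_aeval_eval_le' (P := C) hg hK h10 hd1 hCΔ'
  -- `ρ(h) = P_w + O(ε)`: the substitution has coefficients in `F`
  have hIMM : aeval (wordSubst k pos (LaurentSeries F) hn')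
      (MvPolynomial.map (algebraMap F (LaurentSeries F)) (immMatrix (Fin n) d F 0 0)) =
      MvPolynomial.map (algebraMap F (LaurentSeries F)) (wordPoly k pos F) := by
    rw [map_immMatrix_apply, aeval_wordSubst_immMatrix_zero k pos (LaurentSeries F) hn' hd1,
      map_wordPoly]
  have hE : PolyOrdGE 1 (aeval (wordSubst k pos (LaurentSeries F) hn') C.eval -
      MvPolynomial.map (algebraMap F (LaurentSeries F)) (wordPoly k pos F)) := by
    rw [hCh, ← hIMM, ← map_sub, MvPolynomial.aeval_eq_bind₁]
    refine hord.bind₁ fun v => ?_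
    rw [← map_wordSubst k pos F hn' (algebraMap F (LaurentSeries F)) v]
    exact PolyOrdGE.map_algebraMap _
  -- lower bound over `F`, transported to `K`; upper bound over `K`
  have hlow := relRank_wordPoly_ge k pos F (hover d le_rfl)
  have hmid := relRank_le_of_polyOrdGE pos Finset.univ (wordPoly k pos F) _ hE
  have hstar := (hlow.trans hmid).trans hup
  -- the remaining numeric hypotheses
  have hN : ((Fintype.card (Fin d × Fin n × Fin n) : ℕ) : ℝ) + 1 ≤ (2 : ℝ) ^ (6 * (k : ℝ)) := by
    rw [Fintype.card_prod, Fintype.card_prod, Fintype.card_fin, Fintype.card_fin]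
    push_cast
    have hdn' : (d : ℝ) + 1 ≤ n := by
      have := Real.add_one_le_exp (Real.log n)
      rw [Real.exp_log (by linarith)] at this
      have : (d : ℝ) ≤ (1 / 40) * Real.log n := by nlinarith [hdk, hlogk]
      linarith
    have hn1 : (1 : ℝ) ≤ n := by linarith
    calc (d : ℝ) * ((n : ℝ) * n) + 1 ≤ (n - 1) * (n * n) + n * n := by nlinarith
      _ = (n : ℝ) ^ 3 := by ring
      _ ≤ ((2 : ℝ) ^ ((k : ℝ) + 1)) ^ 3 := pow_le_pow_left₀ (by linarith) hn2kR.le 3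
      _ = (2 : ℝ) ^ (3 * ((k : ℝ) + 1)) := by
          rw [← Real.rpow_natCast, ← Real.rpow_mul (by norm_num)]; congr 1; push_cast; ring
      _ ≤ (2 : ℝ) ^ (6 * (k : ℝ)) := two_rpow_le_two_rpow (by
          have : (1 : ℝ) ≤ k := by exact_mod_cast hk1
          linarith)
  have hsqrt : Real.sqrt n ≤ (2 : ℝ) ^ (k : ℝ) := by
    have hn4 : (4 : ℝ) ≤ n := by
      have := Real.add_one_le_exp (Real.log n)
      rw [Real.exp_log (by linarith)] at this
      linarith
    have h1 : Real.sqrt n ≤ n / 2 := by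
      calc Real.sqrt n ≤ Real.sqrt (((n : ℝ) / 2) ^ 2) := Real.sqrt_le_sqrt (by nlinarith)
        _ = n / 2 := Real.sqrt_sq (by positivity)
    have h2 : (n : ℝ) / 2 ≤ (2 : ℝ) ^ (k : ℝ) := by
      rw [div_le_iff₀ (by norm_num)]
      have : (2 : ℝ) ^ ((k : ℝ) + 1) = (2 : ℝ) ^ (k : ℝ) * 2 := by
        rw [Real.rpow_add (by norm_num), Real.rpow_one]
      linarith
    exact h1.trans h2
  have hfin := H n d C.size (Fintype.card (Fin d × Fin n × Fin n)) k hd hdk h10 hk1 hN hsqrt hn2R hstar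
  exact hfin.trans (by exact_mod_cast hCs)

/-- **Andrews–Forbes 2022, Corollary 6.5, with uniform constants** (border-robust LST): for
every product-depth `Δ ≥ 1` there are `δ > 0` and `d₀`, depending on `Δ` only, such that over
every field `F`, for all `n` and all `d₀ ≤ d ≤ (log n)/100` with `char F = 0` or `char F > d`:
every circuit of product-depth `≤ Δ` over `F((ε))` computing
`IMM_{n,d} + O(ε)` (`IMM_{n,d}` = the `(1,1)` entry of a product of `d` generic `n × n` matrices)
has at least `n^{d^δ}` wires. The printed range `d ≤ (log n)/100` is served from the engine's
`d ≤ ε(Δ) log n` by truncating `IMM_{n,d}` to `IMM_{n,d'}`, `d' = min(d, ⌊ε log n⌋)`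
(`BorderLST.immMatrix_mem_borderClass_of_le`), at the price of halving `δ`. This uniform form
(constants independent of `F`) is the one Lemma 6.6's universal constant needs.
[cite: AndrewsForbes2022, Cor. 6.5] -/
theorem AndrewsForbes2022_cor_6_5_explicit {Δ : ℕ} (hΔ : 1 ≤ Δ) :
    ∃ δ : ℝ, 0 < δ ∧ ∃ d₀ : ℕ, ∀ (F : Type) [Field F] (n d : ℕ) [NeZero n],
      d₀ ≤ d → (d : ℝ) ≤ Real.log n / 100 → (ringChar F = 0 ∨ d < ringChar F) →
      ∀ s : ℕ, immMatrix (Fin n) d F 0 0 ∈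
          borderClass F (productDepthEdgeClass (LaurentSeries F) (Fin d × Fin n × Fin n) s Δ) →
        (n : ℝ) ^ ((d : ℝ) ^ δ) ≤ s := by
  obtain ⟨δ, hδ, ε, hε, d₀, hd₀, H⟩ := AndrewsForbes2022_cor_6_5_engine hΔ
  -- thresholds: `50 ε d ≥ d₀ + 1`, `(50 ε)² d ≥ 1`, `d ≥ d₀`
  obtain ⟨T, hT⟩ : ∃ T : ℕ, ((d₀ : ℝ) + 1) / (50 * ε) ≤ T ∧ 1 / (50 * ε) ^ 2 ≤ T ∧ d₀ ≤ T := by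
    refine ⟨⌈((d₀ : ℝ) + 1) / (50 * ε)⌉₊ + ⌈1 / (50 * ε) ^ 2⌉₊ + d₀, ?_, ?_, by omega⟩
    · have := Nat.le_ceil (((d₀ : ℝ) + 1) / (50 * ε))
      push_cast; linarith [Nat.cast_nonneg (α := ℝ) (⌈1 / (50 * ε) ^ 2⌉₊), Nat.cast_nonneg (α := ℝ) d₀]
    · have := Nat.le_ceil (1 / (50 * ε) ^ 2)
      push_cast
      linarith [Nat.cast_nonneg (α := ℝ) (⌈((d₀ : ℝ) + 1) / (50 * ε)⌉₊), Nat.cast_nonneg (α := ℝ) d₀]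
  obtain ⟨hT1, hT2, hT3⟩ := hT
  refine ⟨δ / 2, by positivity, T, ?_⟩
  intro F _ n d _ hd hdn hchar s hmem
  have hF : ∀ d' : ℕ, d' ≤ d → ∀ i : ℕ, 0 < i → i ≤ d' → (i : F) ≠ 0 :=
    fun d' hd' i hi hid => BorderLST.natCast_ne_zero_of_ringChar hchar hi (hid.trans hd')
  have hTd : (T : ℝ) ≤ d := by exact_mod_cast hd
  have hd₀d : d₀ ≤ d := hT3.trans hd
  have hd1 : 1 ≤ d := hd₀.trans hd₀d
  have hdR : (1 : ℝ) ≤ d := by exact_mod_cast hd1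
  have hn1 : (1 : ℝ) ≤ n := by exact_mod_cast Nat.one_le_iff_ne_zero.2 (NeZero.ne n)
  have hε50 : 0 < 50 * ε := by positivity
  -- `d^{δ/2} ≤ d'^δ` whenever `50 ε d ≤ d'`
  have hexp : ∀ d' : ℕ, 50 * ε * d ≤ (d' : ℝ) → (d : ℝ) ^ (δ / 2) ≤ (d' : ℝ) ^ δ := by
    intro d' hd'
    have hposd : (0 : ℝ) < d := by linarith
    -- `(50ε)² d ≥ 1`
    have h1 : (1 : ℝ) ≤ (50 * ε) ^ 2 * d := by
      rw [div_le_iff₀ (by positivity)] at hT2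
      nlinarith
    -- `d^{δ/2} ≤ ((50ε)² d)^{δ/2} d^{δ/2} = ((50 ε) d)^δ ≤ d'^δ`
    calc (d : ℝ) ^ (δ / 2) ≤ ((50 * ε) ^ 2 * d) ^ (δ / 2) * (d : ℝ) ^ (δ / 2) := by
          refine le_mul_of_one_le_left (by positivity) (Real.one_le_rpow h1 (by positivity))
      _ = (50 * ε * d) ^ δ := by
          rw [← Real.mul_rpow (by positivity) (by positivity)]
          rw [show (50 * ε) ^ 2 * (d : ℝ) * d = (50 * ε * d) ^ 2 by ring]
          rw [← Real.rpow_natCast, ← Real.rpow_mul (by positivity)]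
          congr 1; push_cast; ring
      _ ≤ (d' : ℝ) ^ δ := Real.rpow_le_rpow (by positivity) hd' hδ.le
  by_cases hcase : (d : ℝ) ≤ ε * Real.log n
  · -- engine range directly; `d^{δ/2} ≤ d^δ` for `d ≥ 1`
    have h := H F n d hd₀d (hF d le_rfl) hcase s hmem
    refine le_trans (Real.rpow_le_rpow_of_exponent_le hn1 ?_) h
    exact Real.rpow_le_rpow_of_exponent_le hdR (by linarith)
  · push Not at hcase
    set d' := ⌊ε * Real.log n⌋₊ with hd'
    have hlog0 : 0 ≤ ε * Real.log n := by
      have : 0 ≤ Real.log n := Real.log_nonneg hn1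
      positivity
    have hd'le : (d' : ℝ) ≤ ε * Real.log n := Nat.floor_le hlog0
    have hd'ge : ε * Real.log n - 1 ≤ d' := by
      have := Nat.lt_floor_add_one (ε * Real.log n); linarith
    have hlogd : 100 * (d : ℝ) ≤ Real.log n := by
      rw [le_div_iff₀ (by norm_num)] at hdn; linarith
    have h50 : 50 * ε * d ≤ (d' : ℝ) := by
      -- `d' ≥ 100 ε d - 1 ≥ 50 ε d` as `50 ε d ≥ 1`
      have h1 : (1 : ℝ) ≤ 50 * ε * d := by
        rw [div_le_iff₀ hε50] at hT1
        nlinarith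
      nlinarith
    have hd'd : d' ≤ d := by
      have : (d' : ℝ) ≤ d := by linarith
      exact_mod_cast this
    have hd₀d' : d₀ ≤ d' := by
      have : (d₀ : ℝ) + 1 ≤ 50 * ε * d := by
        rw [div_le_iff₀ hε50] at hT1; nlinarith
      have : (d₀ : ℝ) ≤ d' := by linarith
      exact_mod_cast this
    have hmem' := BorderLST.immMatrix_mem_borderClass_of_le hd'd 0 0 hmem
    have h := H F n d' hd₀d' (hF d' hd'd) hd'le s hmem'
    refine le_trans ?_ h
    exact Real.rpow_le_rpow_of_exponent_le hn1 (hexp d' h50)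

/-- **Discharge of the named fact `AndrewsForbes2022_cor_6_5`** (Andrews–Forbes 2022, Cor. 6.5,
BOTH bullets — `char F = 0` and `char F = p > d` —, in the typed shape of
`AndrewsForbes2022Applications.lean`): for every field `F` and `Δ ≥ 1` there are `δ > 0` and `d₀`
such that for all `n` and `d₀ ≤ d ≤ (log n)/100` with `char F = 0` or `> d`,
`IMM_{n,d} ∈` the closure of product-depth-`Δ` wire-size-`s` circuits forces `n^{d^δ} ≤ s`.
PROVED (border-robustness of [LST21], AF22 Lemmas 6.1–6.4, re-run in the kernel); the constants
are in fact independent of `F` (`AndrewsForbes2022_cor_6_5_explicit`).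
[cite: AndrewsForbes2022, Cor. 6.5] -/
theorem AndrewsForbes2022_cor_6_5_holds : AndrewsForbes2022_cor_6_5 := by
  intro F _ Δ hΔ
  obtain ⟨δ, hδ, d₀, H⟩ := AndrewsForbes2022_cor_6_5_explicit hΔ
  exact ⟨δ, hδ, d₀, fun n d _ hd hdn hch s hmem => H F n d hd hdn hch s hmem⟩

/-! ## Explicit exponents (for Lemma 6.6's universal constant) -/

namespace BorderLST

set_option maxHeartbeats 1600000 in
/-- **The final estimate with the explicit exponent `δ = μ_Δ/2`** (copy of `LSTWord.final_arith`,
`ConstantDepthIMMProofs.lean`, whose statement hides `δ`; LST 2025, proof of Cor. 4, p. 26:13: "`d^{O(d)} poly(s) ≥`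
`n^{Ω(d^{1/(2^Δ̃-1)}/Δ̃)}` … by the assumption `d ≤ (log n)/100`, we get the desired lower bound
for `s`"):
for `Δ ≥ 1` there are `δ, ε > 0` (`ε ≤ 1/40`) and `d₀ ≥ 1` such that whenever `d₀ ≤ d`,
`d ≤ ε (k+1)`, `10 d ≤ k`, `1 ≤ k`, `N + 1 ≤ 2^{6k}`, `√n ≤ 2^k`, `2 ≤ n` and
`2^{-k/2} ≤ Λ_Δ(s, N, d) Φ_Δ(d)`, then `n^{d^δ} ≤ s`. [cite: LimayeSrinivasanTavenas2025, Cor. 4] -/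
theorem final_arith_mu {Δ : ℕ} (hΔ : 1 ≤ Δ) :
    ∃ ε : ℝ, 0 < ε ∧ ε ≤ 1 / 40 ∧ ∃ d₀ : ℕ, 1 ≤ d₀ ∧
      ∀ (n d s N k : ℕ), d₀ ≤ d → (d : ℝ) ≤ ε * ((k : ℝ) + 1) → 10 * d ≤ k → 1 ≤ k →
        (N : ℝ) + 1 ≤ (2 : ℝ) ^ (6 * (k : ℝ)) → Real.sqrt n ≤ (2 : ℝ) ^ (k : ℝ) → (2 : ℝ) ≤ n →
        (2 : ℝ) ^ (-(k : ℝ) / 2) ≤ Lam s N d Δ * Phi k Δ d →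
        (n : ℝ) ^ ((d : ℝ) ^ (mu Δ / 2)) ≤ s := by
  obtain ⟨μ, hμdef⟩ : ∃ μ : ℝ, mu Δ = μ := ⟨_, rfl⟩
  rw [hμdef]
  have hμ0 : 0 < μ := hμdef ▸ mu_pos Δ
  have hμ1 : μ ≤ 1 := hμdef ▸ mu_le_one Δ
  have hΔR : (1 : ℝ) ≤ Δ := by exact_mod_cast hΔ
  obtain ⟨ε, hεdef⟩ : ∃ ε : ℝ, μ / (30000 * Δ) = ε := ⟨_, rfl⟩
  have hε0 : 0 < ε := by rw [← hεdef]; positivity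
  have hε40 : ε ≤ 1 / 40 := by
    rw [← hεdef, div_le_div_iff₀ (by positivity) (by norm_num)]; nlinarith
  obtain ⟨Cst, hCst⟩ : ∃ C : ℝ, 409600 * (Δ : ℝ) ^ 2 + 1440 * ((Δ : ℝ) + 1) = C := ⟨_, rfl⟩
  have hCst0 : 0 ≤ Cst := by rw [← hCst]; positivity
  refine ⟨ε, hε0, hε40, ⌈Cst ^ (1 / μ)⌉₊ + 1, by omega, ?_⟩
  intro n d s N k hd hdk h10 hk1 hN hsqrt hn2 hstar
  -- basic positivity
  have hd1 : 1 ≤ d := le_trans (by omega) hd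
  have hdR : (1 : ℝ) ≤ d := by exact_mod_cast hd1
  have hkR : (1 : ℝ) ≤ k := by exact_mod_cast hk1
  have hdμ : Cst ≤ (d : ℝ) ^ μ := le_rpow_of_ceil_le hCst0 hμ0 hd
  have hdμ1 : (1 : ℝ) ≤ (d : ℝ) ^ μ := Real.one_le_rpow hdR hμ0.le
  have hdμ2 : (1 : ℝ) ≤ (d : ℝ) ^ (μ / 2) := Real.one_le_rpow hdR (by positivity)
  have hsq : ((d : ℝ) ^ (μ / 2)) ^ 2 = (d : ℝ) ^ μ := by
    rw [← Real.rpow_natCast, ← Real.rpow_mul (by linarith)]; congr 1; push_cast; ring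
  -- `E = k d^μ`
  obtain ⟨E, hE⟩ : ∃ E : ℝ, (k : ℝ) * (d : ℝ) ^ μ = E := ⟨_, rfl⟩
  have hE0 : 0 ≤ E := by rw [← hE]; positivity
  have hEk : (k : ℝ) * Cst ≤ E := by rw [← hE]; exact mul_le_mul_of_nonneg_left hdμ (by linarith)
  -- Step 1: `2^{E/40} ≤ Λ`
  obtain ⟨Λ, hΛdef⟩ : ∃ L : ℝ, Lam s N d Δ = L := ⟨_, rfl⟩
  have hΛ1 : 1 ≤ Λ := hΛdef ▸ one_le_Lam _ _ _ _
  have hstep1 : (2 : ℝ) ^ (E / 40) ≤ Λ := by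
    have hPhi : Phi k Δ (d : ℝ) = (2 : ℝ) ^ (-(E / 20)) := by
      unfold Phi; rw [hμdef]; congr 1; rw [← hE]; ring
    rw [hPhi, hΛdef] at hstar
    have h1 : (2 : ℝ) ^ (-(k : ℝ) / 2 + E / 20) ≤ Λ := by
      rw [Real.rpow_add two_pos]
      calc (2 : ℝ) ^ (-(k : ℝ) / 2) * (2 : ℝ) ^ (E / 20)
          ≤ Λ * (2 : ℝ) ^ (-(E / 20)) * (2 : ℝ) ^ (E / 20) :=
            mul_le_mul_of_nonneg_right hstar (by positivity)
        _ = Λ := by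
            rw [mul_assoc, ← Real.rpow_add two_pos, neg_add_cancel, Real.rpow_zero, mul_one]
    refine le_trans (two_rpow_le_two_rpow ?_) h1
    -- `E/40 ≤ -k/2 + E/20` iff `20 k ≤ E`, from `d^μ ≥ 20`
    have : (20 : ℝ) * k ≤ E := by
      have h20 : (20 : ℝ) ≤ Cst := by rw [← hCst]; nlinarith
      nlinarith
    linarith
  -- Step 2: `Λ ≤ 2^Δ (s+1)^{2Δ} (N+1)^{Δ+1} (d+1)^{(5d+1)Δ}`
  have hs0 : (0 : ℝ) ≤ s := Nat.cast_nonneg s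
  have hN0 : (0 : ℝ) ≤ N := Nat.cast_nonneg N
  obtain ⟨P, hP⟩ : ∃ P : ℝ, P = ((d : ℝ) + 1) ^ (5 * d + 1) := ⟨_, rfl⟩
  have hP1 : (1 : ℝ) ≤ P := by rw [hP]; exact one_le_pow₀ (by linarith)
  have hP0 : (0 : ℝ) < P := by linarith
  have hΛle : Λ ≤ (2 : ℝ) ^ Δ * ((s : ℝ) + 1) ^ (2 * Δ) * ((N : ℝ) + 1) ^ (Δ + 1) * P ^ Δ := by
    rw [← hΛdef, Lam_eq]
    have hsc := stepConst_le s N d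
    rw [← hP] at hsc
    calc (stepConst s N d : ℝ) ^ Δ * ((N : ℝ) + 1)
        ≤ (2 * ((s : ℝ) + 1) ^ 2 * ((N : ℝ) + 1) * P) ^ Δ * ((N : ℝ) + 1) :=
          mul_le_mul_of_nonneg_right (pow_le_pow_left₀ (Nat.cast_nonneg _) hsc Δ) (by positivity)
      _ = (2 : ℝ) ^ Δ * ((s : ℝ) + 1) ^ (2 * Δ) * ((N : ℝ) + 1) ^ (Δ + 1) * P ^ Δ := by
          rw [mul_pow, mul_pow, mul_pow, ← pow_mul, pow_succ]; ring
  -- Step 3: the three junk factors are `≤ 2^{E/240}` each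
  have hj1 : (2 : ℝ) ^ Δ ≤ (2 : ℝ) ^ (E / 240) := by
    rw [← Real.rpow_natCast]
    refine two_rpow_le_two_rpow ?_
    have h240 : (240 : ℝ) * Δ ≤ Cst := by rw [← hCst]; nlinarith
    have hkC : Cst ≤ (k : ℝ) * Cst := le_mul_of_one_le_left hCst0 hkR
    linarith
  have hj2 : ((N : ℝ) + 1) ^ (Δ + 1) ≤ (2 : ℝ) ^ (E / 240) := by
    calc ((N : ℝ) + 1) ^ (Δ + 1) ≤ ((2 : ℝ) ^ (6 * (k : ℝ))) ^ (Δ + 1) :=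
          pow_le_pow_left₀ (by positivity) hN _
      _ = (2 : ℝ) ^ (6 * (k : ℝ) * (Δ + 1)) := by
          rw [← Real.rpow_natCast, ← Real.rpow_mul (by norm_num)]; push_cast; ring_nf
      _ ≤ (2 : ℝ) ^ (E / 240) := two_rpow_le_two_rpow (by
          have h1440 : (1440 : ℝ) * ((Δ : ℝ) + 1) ≤ Cst := by rw [← hCst]; nlinarith
          have hkE : (k : ℝ) * (1440 * ((Δ : ℝ) + 1)) ≤ E :=
            le_trans (mul_le_mul_of_nonneg_left h1440 (by linarith)) hEk
          linarith)
  have hj3 : P ^ Δ ≤ (2 : ℝ) ^ (E / 240) := by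
    -- compare logarithms
    have hPΔ : 0 < P ^ Δ := pow_pos hP0 Δ
    have h2E : (0 : ℝ) < (2 : ℝ) ^ (E / 240) := Real.rpow_pos_of_pos two_pos _
    rw [← Real.log_le_log_iff hPΔ h2E, Real.log_pow, Real.log_rpow two_pos]
    have hlogP : Real.log P = ((5 * d + 1 : ℕ) : ℝ) * Real.log ((d : ℝ) + 1) := by
      rw [hP, Real.log_pow]
    rw [hlogP]
    have hlog := log_succ_le hμ0 hμ1 hd1
    have hlog2 : (1 / 2 : ℝ) ≤ Real.log 2 := by
      have := Real.log_two_gt_d9; linarith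
    -- `d ≤ 2 ε k`
    have hdk2 : (d : ℝ) ≤ 2 * ε * k := by nlinarith
    -- LHS ≤ Δ (5d+1) (4/μ) d^{μ/2} ≤ (24 Δ/μ) d^{1+μ/2}
    have h5 : ((5 * d + 1 : ℕ) : ℝ) ≤ 6 * d := by push_cast; linarith
    have hl0 : 0 ≤ Real.log ((d : ℝ) + 1) := Real.log_nonneg (by linarith)
    have hdd : 0 ≤ (d : ℝ) * (d : ℝ) ^ (μ / 2) := by positivity
    have hlhs : (Δ : ℝ) * (((5 * d + 1 : ℕ) : ℝ) * Real.log ((d : ℝ) + 1)) ≤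
        24 * Δ / μ * ((d : ℝ) * (d : ℝ) ^ (μ / 2)) := by
      have h1 : ((5 * d + 1 : ℕ) : ℝ) * Real.log ((d : ℝ) + 1) ≤
          (6 * d) * (4 / μ * (d : ℝ) ^ (μ / 2)) := mul_le_mul h5 hlog hl0 (by positivity)
      have h2 : (Δ : ℝ) * ((6 * d) * (4 / μ * (d : ℝ) ^ (μ / 2))) =
          24 * Δ / μ * ((d : ℝ) * (d : ℝ) ^ (μ / 2)) := by ring
      rw [← h2]
      exact mul_le_mul_of_nonneg_left h1 (by positivity)
    -- RHS ≥ 2 ε E ≥ d d^μ … in the form `d d^μ/(960 ε) ≤ E/240 · log 2`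
    have hrhs : (d : ℝ) * (d : ℝ) ^ μ / (960 * ε) ≤ E / 240 * Real.log 2 := by
      have hdμ0 : 0 ≤ (d : ℝ) ^ μ := by positivity
      have h1 : (d : ℝ) * (d : ℝ) ^ μ ≤ 2 * ε * E := by
        rw [← hE]
        have := mul_le_mul_of_nonneg_right hdk2 hdμ0
        nlinarith
      rw [div_le_iff₀ (by positivity)]
      have h2 : E * ε * (1 / 2) ≤ E * ε * Real.log 2 :=
        mul_le_mul_of_nonneg_left hlog2 (by positivity)
      nlinarith
    -- compare: `24Δ/μ · d^{1+μ/2} ≤ d^{1+μ}/(960 ε)` since `d^{μ/2} ≥ 1` and `ε = μ/(30000Δ)`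
    have hmid : 24 * Δ / μ * ((d : ℝ) * (d : ℝ) ^ (μ / 2)) ≤ (d : ℝ) * (d : ℝ) ^ μ / (960 * ε) := by
      rw [le_div_iff₀ (by positivity), ← hsq]
      have hprod : 30000 * (Δ : ℝ) * ε = μ := by
        rw [← hεdef]; exact mul_div_cancel₀ μ (by positivity)
      have hcoef : 24 * (Δ : ℝ) / μ * (960 * ε) ≤ 1 := by
        rw [div_mul_eq_mul_div, div_le_one hμ0]
        have : (0 : ℝ) ≤ (Δ : ℝ) * ε := by positivity
        nlinarith
      calc 24 * Δ / μ * ((d : ℝ) * (d : ℝ) ^ (μ / 2)) * (960 * ε)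
          = (24 * (Δ : ℝ) / μ * (960 * ε)) * ((d : ℝ) * (d : ℝ) ^ (μ / 2)) := by ring
        _ ≤ 1 * ((d : ℝ) * (d : ℝ) ^ (μ / 2)) := mul_le_mul_of_nonneg_right hcoef hdd
        _ ≤ (d : ℝ) * ((d : ℝ) ^ (μ / 2)) ^ 2 := by
            rw [one_mul, sq, ← mul_assoc]
            exact le_mul_of_one_le_right hdd hdμ2
    linarith
  -- Step 4: `(s+1)^{2Δ} ≥ 2^{E/80}`
  have hstep4 : (2 : ℝ) ^ (E / 80) ≤ ((s : ℝ) + 1) ^ (2 * Δ) := by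
    have hjunk : (2 : ℝ) ^ Δ * ((N : ℝ) + 1) ^ (Δ + 1) * P ^ Δ ≤ (2 : ℝ) ^ (E / 80) := by
      calc (2 : ℝ) ^ Δ * ((N : ℝ) + 1) ^ (Δ + 1) * P ^ Δ
          ≤ (2 : ℝ) ^ (E / 240) * (2 : ℝ) ^ (E / 240) * (2 : ℝ) ^ (E / 240) :=
            mul_le_mul (mul_le_mul hj1 hj2 (by positivity) (by positivity)) hj3 (by positivity)
              (by positivity)
        _ = (2 : ℝ) ^ (E / 80) := by
            rw [← Real.rpow_add (by norm_num), ← Real.rpow_add (by norm_num)]; congr 1; ring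
    have h := hstep1.trans hΛle
    -- `2^{E/40} ≤ (s+1)^{2Δ} · 2^{E/80}`
    have h' : (2 : ℝ) ^ (E / 40) ≤ ((s : ℝ) + 1) ^ (2 * Δ) * (2 : ℝ) ^ (E / 80) := by
      calc (2 : ℝ) ^ (E / 40) ≤ (2 : ℝ) ^ Δ * ((s : ℝ) + 1) ^ (2 * Δ) * ((N : ℝ) + 1) ^ (Δ + 1) * P ^ Δ := h
        _ = ((s : ℝ) + 1) ^ (2 * Δ) * ((2 : ℝ) ^ Δ * ((N : ℝ) + 1) ^ (Δ + 1) * P ^ Δ) := by ring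
        _ ≤ ((s : ℝ) + 1) ^ (2 * Δ) * (2 : ℝ) ^ (E / 80) :=
            mul_le_mul_of_nonneg_left hjunk (by positivity)
    have hsplit : (2 : ℝ) ^ (E / 40) = (2 : ℝ) ^ (E / 80) * (2 : ℝ) ^ (E / 80) := by
      rw [← Real.rpow_add (by norm_num)]; congr 1; ring
    rw [hsplit] at h'
    exact le_of_mul_le_mul_right h' (by positivity)
  -- Step 5: `s + 1 ≥ 2^{E/(160Δ)} ≥ n^{d^μ/(320Δ)} ≥ n^{2 d^{μ/2}}`
  have hstep5 : (2 : ℝ) ^ (E / (160 * Δ)) ≤ (s : ℝ) + 1 := by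
    have h1 : ((2 : ℝ) ^ (E / (160 * Δ))) ^ (2 * Δ) = (2 : ℝ) ^ (E / 80) := by
      rw [← Real.rpow_natCast, ← Real.rpow_mul (by norm_num)]
      congr 1
      push_cast
      rw [div_mul_eq_mul_div, div_eq_div_iff (by positivity) (by norm_num)]
      ring
    rw [← h1] at hstep4
    exact le_of_pow_le_pow_left₀ (by omega) (by positivity) hstep4
  have hn1 : (1 : ℝ) ≤ n := by linarith
  have hstep6 : (n : ℝ) ^ (2 * (d : ℝ) ^ (μ / 2)) ≤ (s : ℝ) + 1 := by
    refine le_trans ?_ hstep5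
    calc (n : ℝ) ^ (2 * (d : ℝ) ^ (μ / 2)) ≤ (n : ℝ) ^ ((d : ℝ) ^ μ / (320 * Δ)) := by
          refine Real.rpow_le_rpow_of_exponent_le hn1 ?_
          rw [le_div_iff₀ (by positivity), ← hsq]
          have h640 : (640 : ℝ) * Δ ≤ (d : ℝ) ^ (μ / 2) := by
            have : (640 * (Δ : ℝ)) ^ 2 ≤ ((d : ℝ) ^ (μ / 2)) ^ 2 := by
              rw [hsq]; refine le_trans ?_ hdμ; rw [← hCst]; nlinarith
            exact (pow_le_pow_iff_left₀ (by positivity) (by positivity) two_ne_zero).1 this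
          nlinarith
      _ = ((Real.sqrt n) ^ 2) ^ ((d : ℝ) ^ μ / (320 * Δ)) := by rw [Real.sq_sqrt (by linarith)]
      _ = (Real.sqrt n) ^ ((d : ℝ) ^ μ / (160 * Δ)) := by
          rw [← Real.rpow_natCast, ← Real.rpow_mul (Real.sqrt_nonneg _)]
          congr 1
          push_cast
          rw [mul_div_assoc', div_eq_div_iff (by positivity) (by positivity)]
          ring
      _ ≤ ((2 : ℝ) ^ (k : ℝ)) ^ ((d : ℝ) ^ μ / (160 * Δ)) :=
          Real.rpow_le_rpow (Real.sqrt_nonneg _) hsqrt (by positivity)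
      _ = (2 : ℝ) ^ (E / (160 * Δ)) := by
          rw [← Real.rpow_mul (by norm_num)]; congr 1; rw [← hE]; ring
  -- Step 6: `n^{2x} ≥ n^x + 1`
  have hx : (2 : ℝ) ≤ (n : ℝ) ^ ((d : ℝ) ^ (μ / 2)) := by
    calc (2 : ℝ) ≤ n := hn2
      _ = (n : ℝ) ^ (1 : ℝ) := (Real.rpow_one _).symm
      _ ≤ (n : ℝ) ^ ((d : ℝ) ^ (μ / 2)) := Real.rpow_le_rpow_of_exponent_le hn1 hdμ2
  have hfin : (n : ℝ) ^ ((d : ℝ) ^ (μ / 2)) + 1 ≤ (n : ℝ) ^ (2 * (d : ℝ) ^ (μ / 2)) := by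
    rw [show 2 * (d : ℝ) ^ (μ / 2) = (d : ℝ) ^ (μ / 2) + (d : ℝ) ^ (μ / 2) by ring,
      Real.rpow_add (by linarith)]
    nlinarith
  linarith


end BorderLST

/-- The LST exponents decay at most geometrically: `μ_p ≥ 7^{-p}` (`μ_{p+1} = μ_p/(4+3μ_p) ≥ μ_p/7`
as `μ_p ≤ 1`); this is what makes Lemma 6.6's constant `c` in `exp(-cΔ)` universal.
[cite: LimayeSrinivasanTavenas2025, Claim 16] -/
theorem BorderLST.pow_inv_seven_le_mu (p : ℕ) : (1 / 7 : ℝ) ^ p ≤ mu p := by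
  induction p with
  | zero => simp [mu]
  | succ p ih =>
    have hp := mu_pos p
    have h1 := mu_le_one p
    rw [pow_succ]
    show (1 / 7 : ℝ) ^ p * (1 / 7) ≤ mu (p + 1)
    simp only [mu]
    rw [le_div_iff₀ (by positivity)]
    nlinarith

/-- **Border-robust LST, engine range, explicit exponent `μ_Δ/2`** (as
`AndrewsForbes2022_cor_6_5_engine`, with the exponent named: `μ_Δ` of `LowDepthRankBound.lean`,
`μ_0 = 1`, `μ_{p+1} = μ_p/(4+3μ_p) ≥ μ_p/7`; Andrews–Forbes 2022, Lemmas 6.1–6.4 / Cor. 6.5, in the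
parameter range of the tree's LST engine): for every product-depth `Δ ≥ 1` there are
`δ, ε > 0` and `d₀ ≥ 1` — depending on `Δ` ONLY — such that over every field `F` in which
`1, …, d` are invertible (`char F = 0` or `> d`), for all `n` and `d₀ ≤ d ≤ ε log n`: if `(X^{(0)} ⋯ X^{(d-1)})_{00} + O(ε)` is computed by a
circuit of product-depth `≤ Δ` with `s` wires over `F((ε))`, then `n^{d^δ} ≤ s`. Proof = the LST
engine (`LSTWord.relRank_aeval_eval_le'` — the large-characteristic form of
`LowDepthRankBoundLargeChar.lean` —, `relRank_wordPoly_ge`, `final_arith`) run over the FIELD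
`F((ε))` on the empty-gate-pruned border circuit, with the rank compared over `F` and over `F((ε))`
by `BorderLST.relRank_le_of_polyOrdGE` (Lemma 6.2: "`P_w` can be obtained as a projection of
`P_w + O(ε)` by setting `ε = 0`"). [cite: AndrewsForbes2022, Cor. 6.5] -/
theorem AndrewsForbes2022_cor_6_5_engine_mu {Δ : ℕ} (hΔ : 1 ≤ Δ) :
    ∃ ε : ℝ, 0 < ε ∧ ∃ d₀ : ℕ, 1 ≤ d₀ ∧
      ∀ (F : Type) [Field F] (n d : ℕ) [NeZero n], d₀ ≤ d →
      (∀ i : ℕ, 0 < i → i ≤ d → (i : F) ≠ 0) → (d : ℝ) ≤ ε * Real.log n →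
      ∀ s : ℕ, immMatrix (Fin n) d F 0 0 ∈
          borderClass F (productDepthEdgeClass (LaurentSeries F) (Fin d × Fin n × Fin n) s Δ) →
        (n : ℝ) ^ ((d : ℝ) ^ (mu Δ / 2)) ≤ s := by
  obtain ⟨ε, hε, hε40, d₀, hd₀, H⟩ := BorderLST.final_arith_mu hΔ
  refine ⟨ε, hε, d₀, hd₀, ?_⟩
  intro F _ n d _ hd hF hdn s hmem
  -- the border circuit, pruned of its empty gates
  obtain ⟨h, ⟨P, hPh, hPΔ, hPs⟩, hord⟩ := hmem
  -- `1, …, d` are invertible in `F((ε))` as in `F`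
  have hK : ∀ i : ℕ, 0 < i → i ≤ d → (i : LaurentSeries F) ≠ 0 := by
    intro i hi hid
    rw [← map_natCast (algebraMap F (LaurentSeries F)) i]
    exact (map_ne_zero_iff _ (algebraMap F (LaurentSeries F)).injective).2 (hF i hi hid)
  obtain ⟨C, hCeval, hCΔ, hCedge, hCsize⟩ := P.exists_size_le_edgeSize
  have hCh : C.eval = h := hCeval.trans hPh
  have hCΔ' : C.productDepth ≤ Δ := hCΔ.trans hPΔ
  have hCs : C.size ≤ s := hCsize.trans (hCedge.trans hPs)
  have hd1 : 1 ≤ d := hd₀.trans hd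
  have hdR : (1 : ℝ) ≤ d := by exact_mod_cast hd1
  -- `log n ≥ d/ε ≥ 40`
  have hlog : (40 : ℝ) ≤ Real.log n := by
    have h1 : (d : ℝ) ≤ (1 / 40) * Real.log n := hdn.trans (by
      by_cases hn : (1 : ℝ) ≤ n
      · exact mul_le_mul_of_nonneg_right hε40 (Real.log_nonneg hn)
      · push Not at hn
        have : Real.log n ≤ 0 := Real.log_nonpos (Nat.cast_nonneg n) hn.le
        nlinarith)
    linarith
  have hn2R : (2 : ℝ) ≤ n := by
    by_contra h
    push Not at h
    have : Real.log n < Real.log 2 := by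
      rcases Nat.eq_zero_or_pos n with hn | hn
      · subst hn; simp; exact Real.log_pos one_lt_two
      · exact Real.log_lt_log (by exact_mod_cast hn) h
    have := Real.log_two_lt_d9
    linarith
  have hn0 : n ≠ 0 := by rintro rfl; simp at hn2R; linarith
  -- `k = ⌊log₂ n⌋`
  set k := Nat.log 2 n with hk
  have h2k : ((2 : ℕ) ^ k : ℕ) ≤ n := Nat.pow_log_le_self 2 hn0
  have hn2k : n < 2 ^ (k + 1) := Nat.lt_pow_succ_log_self one_lt_two n
  have h2kR : (2 : ℝ) ^ (k : ℝ) ≤ n := by rw [Real.rpow_natCast]; exact_mod_cast h2k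
  have hn2kR : (n : ℝ) < (2 : ℝ) ^ ((k : ℝ) + 1) := by
    rw [show (k : ℝ) + 1 = ((k + 1 : ℕ) : ℝ) by push_cast; ring, Real.rpow_natCast]
    exact_mod_cast hn2k
  have hlogk : Real.log n ≤ (k : ℝ) + 1 := by
    have h1 : Real.log n ≤ Real.log ((2 : ℝ) ^ ((k : ℝ) + 1)) :=
      Real.log_le_log (by linarith) hn2kR.le
    rw [Real.log_rpow (by norm_num)] at h1
    have := Real.log_two_lt_d9
    have hk0 : (0 : ℝ) ≤ (k : ℝ) + 1 := by positivity
    nlinarith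
  have hdk : (d : ℝ) ≤ ε * ((k : ℝ) + 1) := hdn.trans (mul_le_mul_of_nonneg_left hlogk hε.le)
  have h10 : 10 * d ≤ k := by
    have : (40 : ℝ) * d ≤ (k : ℝ) + 1 := by nlinarith
    have : 40 * d ≤ k + 1 := by exact_mod_cast this
    omega
  have hk1 : 1 ≤ k := le_trans (by omega) h10
  -- the greedy `k`-unbiased word and the word substitution, over `K = F((ε))`
  set pos := greedyWord d k with hpos
  have hover : ∀ t, t ≤ d → overLen k pos t ≤ k := by
    intro t ht
    rw [overLen_eq_natAbs k pos t ht]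
    have h := abs_prefixSum_greedyWord_le d k t ht
    rw [← hpos, abs_le] at h
    omega
  have hn' : ∀ t, t ≤ d → 2 ^ overLen k pos t ≤ n := fun t ht =>
    (Nat.pow_le_pow_right Nat.two_pos (hover t ht)).trans h2k
  have hg := isBlockPreserving_wordSubst k pos (LaurentSeries F) hn'
  have hup := relRank_aeval_eval_le' (P := C) hg hK h10 hd1 hCΔ'
  -- `ρ(h) = P_w + O(ε)`: the substitution has coefficients in `F`
  have hIMM : aeval (wordSubst k pos (LaurentSeries F) hn')
      (MvPolynomial.map (algebraMap F (LaurentSeries F)) (immMatrix (Fin n) d F 0 0)) =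
      MvPolynomial.map (algebraMap F (LaurentSeries F)) (wordPoly k pos F) := by
    rw [map_immMatrix_apply, aeval_wordSubst_immMatrix_zero k pos (LaurentSeries F) hn' hd1,
      map_wordPoly]
  have hE : PolyOrdGE 1 (aeval (wordSubst k pos (LaurentSeries F) hn') C.eval -
      MvPolynomial.map (algebraMap F (LaurentSeries F)) (wordPoly k pos F)) := by
    rw [hCh, ← hIMM, ← map_sub, MvPolynomial.aeval_eq_bind₁]
    refine hord.bind₁ fun v => ?_
    rw [← map_wordSubst k pos F hn' (algebraMap F (LaurentSeries F)) v]
    exact PolyOrdGE.map_algebraMap _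
  -- lower bound over `F`, transported to `K`; upper bound over `K`
  have hlow := relRank_wordPoly_ge k pos F (hover d le_rfl)
  have hmid := relRank_le_of_polyOrdGE pos Finset.univ (wordPoly k pos F) _ hE
  have hstar := (hlow.trans hmid).trans hup
  -- the remaining numeric hypotheses
  have hN : ((Fintype.card (Fin d × Fin n × Fin n) : ℕ) : ℝ) + 1 ≤ (2 : ℝ) ^ (6 * (k : ℝ)) := by
    rw [Fintype.card_prod, Fintype.card_prod, Fintype.card_fin, Fintype.card_fin]
    push_cast
    have hdn' : (d : ℝ) + 1 ≤ n := by
      have := Real.add_one_le_exp (Real.log n)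
      rw [Real.exp_log (by linarith)] at this
      have : (d : ℝ) ≤ (1 / 40) * Real.log n := by nlinarith [hdk, hlogk]
      linarith
    have hn1 : (1 : ℝ) ≤ n := by linarith
    calc (d : ℝ) * ((n : ℝ) * n) + 1 ≤ (n - 1) * (n * n) + n * n := by nlinarith
      _ = (n : ℝ) ^ 3 := by ring
      _ ≤ ((2 : ℝ) ^ ((k : ℝ) + 1)) ^ 3 := pow_le_pow_left₀ (by linarith) hn2kR.le 3
      _ = (2 : ℝ) ^ (3 * ((k : ℝ) + 1)) := by
          rw [← Real.rpow_natCast, ← Real.rpow_mul (by norm_num)]; congr 1; push_cast; ring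
      _ ≤ (2 : ℝ) ^ (6 * (k : ℝ)) := two_rpow_le_two_rpow (by
          have : (1 : ℝ) ≤ k := by exact_mod_cast hk1
          linarith)
  have hsqrt : Real.sqrt n ≤ (2 : ℝ) ^ (k : ℝ) := by
    have hn4 : (4 : ℝ) ≤ n := by
      have := Real.add_one_le_exp (Real.log n)
      rw [Real.exp_log (by linarith)] at this
      linarith
    have h1 : Real.sqrt n ≤ n / 2 := by
      calc Real.sqrt n ≤ Real.sqrt (((n : ℝ) / 2) ^ 2) := Real.sqrt_le_sqrt (by nlinarith)
        _ = n / 2 := Real.sqrt_sq (by positivity)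
    have h2 : (n : ℝ) / 2 ≤ (2 : ℝ) ^ (k : ℝ) := by
      rw [div_le_iff₀ (by norm_num)]
      have : (2 : ℝ) ^ ((k : ℝ) + 1) = (2 : ℝ) ^ (k : ℝ) * 2 := by
        rw [Real.rpow_add (by norm_num), Real.rpow_one]
      linarith
    exact h1.trans h2
  have hfin := H n d C.size (Fintype.card (Fin d × Fin n × Fin n)) k hd hdk h10 hk1 hN hsqrt hn2R hstar
  exact hfin.trans (by exact_mod_cast hCs)

/-- **Andrews–Forbes 2022, Corollary 6.5, with uniform constants and the explicit exponent
`μ_Δ/4`** (as `AndrewsForbes2022_cor_6_5_explicit`; border-robust LST): for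
every product-depth `Δ ≥ 1` there are `δ > 0` and `d₀`, depending on `Δ` only, such that over
every field `F`, for all `n` and all `d₀ ≤ d ≤ (log n)/100` with `char F = 0` or `char F > d`:
every circuit of product-depth `≤ Δ` over `F((ε))` computing
`IMM_{n,d} + O(ε)` (`IMM_{n,d}` = the `(1,1)` entry of a product of `d` generic `n × n` matrices)
has at least `n^{d^δ}` wires. The printed range `d ≤ (log n)/100` is served from the engine's
`d ≤ ε(Δ) log n` by truncating `IMM_{n,d}` to `IMM_{n,d'}`, `d' = min(d, ⌊ε log n⌋)`
(`BorderLST.immMatrix_mem_borderClass_of_le`), at the price of halving `δ`. This uniform form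
(constants independent of `F`) is the one Lemma 6.6's universal constant needs.
[cite: AndrewsForbes2022, Cor. 6.5] -/
theorem AndrewsForbes2022_cor_6_5_explicit_mu {Δ : ℕ} (hΔ : 1 ≤ Δ) :
    ∃ d₀ : ℕ, ∀ (F : Type) [Field F] (n d : ℕ) [NeZero n],
      d₀ ≤ d → (d : ℝ) ≤ Real.log n / 100 → (ringChar F = 0 ∨ d < ringChar F) →
      ∀ s : ℕ, immMatrix (Fin n) d F 0 0 ∈
          borderClass F (productDepthEdgeClass (LaurentSeries F) (Fin d × Fin n × Fin n) s Δ) →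
        (n : ℝ) ^ ((d : ℝ) ^ (mu Δ / 4)) ≤ s := by
  obtain ⟨ε, hε, d₀, hd₀, H⟩ := AndrewsForbes2022_cor_6_5_engine_mu hΔ
  obtain ⟨δ, hδdef⟩ : ∃ δ : ℝ, mu Δ / 2 = δ := ⟨_, rfl⟩
  have hδ : 0 < δ := by rw [← hδdef]; exact div_pos (mu_pos Δ) two_pos
  rw [show mu Δ / 4 = δ / 2 by rw [← hδdef]; ring]
  rw [hδdef] at H
  -- thresholds: `50 ε d ≥ d₀ + 1`, `(50 ε)² d ≥ 1`, `d ≥ d₀`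
  obtain ⟨T, hT⟩ : ∃ T : ℕ, ((d₀ : ℝ) + 1) / (50 * ε) ≤ T ∧ 1 / (50 * ε) ^ 2 ≤ T ∧ d₀ ≤ T := by
    refine ⟨⌈((d₀ : ℝ) + 1) / (50 * ε)⌉₊ + ⌈1 / (50 * ε) ^ 2⌉₊ + d₀, ?_, ?_, by omega⟩
    · have := Nat.le_ceil (((d₀ : ℝ) + 1) / (50 * ε))
      push_cast; linarith [Nat.cast_nonneg (α := ℝ) (⌈1 / (50 * ε) ^ 2⌉₊), Nat.cast_nonneg (α := ℝ) d₀]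
    · have := Nat.le_ceil (1 / (50 * ε) ^ 2)
      push_cast
      linarith [Nat.cast_nonneg (α := ℝ) (⌈((d₀ : ℝ) + 1) / (50 * ε)⌉₊), Nat.cast_nonneg (α := ℝ) d₀]
  obtain ⟨hT1, hT2, hT3⟩ := hT
  refine ⟨T, ?_⟩
  intro F _ n d _ hd hdn hchar s hmem
  have hF : ∀ d' : ℕ, d' ≤ d → ∀ i : ℕ, 0 < i → i ≤ d' → (i : F) ≠ 0 :=
    fun d' hd' i hi hid => BorderLST.natCast_ne_zero_of_ringChar hchar hi (hid.trans hd')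
  have hTd : (T : ℝ) ≤ d := by exact_mod_cast hd
  have hd₀d : d₀ ≤ d := hT3.trans hd
  have hd1 : 1 ≤ d := hd₀.trans hd₀d
  have hdR : (1 : ℝ) ≤ d := by exact_mod_cast hd1
  have hn1 : (1 : ℝ) ≤ n := by exact_mod_cast Nat.one_le_iff_ne_zero.2 (NeZero.ne n)
  have hε50 : 0 < 50 * ε := by positivity
  -- `d^{δ/2} ≤ d'^δ` whenever `50 ε d ≤ d'`
  have hexp : ∀ d' : ℕ, 50 * ε * d ≤ (d' : ℝ) → (d : ℝ) ^ (δ / 2) ≤ (d' : ℝ) ^ δ := by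
    intro d' hd'
    have hposd : (0 : ℝ) < d := by linarith
    -- `(50ε)² d ≥ 1`
    have h1 : (1 : ℝ) ≤ (50 * ε) ^ 2 * d := by
      rw [div_le_iff₀ (by positivity)] at hT2
      nlinarith
    -- `d^{δ/2} ≤ ((50ε)² d)^{δ/2} d^{δ/2} = ((50 ε) d)^δ ≤ d'^δ`
    calc (d : ℝ) ^ (δ / 2) ≤ ((50 * ε) ^ 2 * d) ^ (δ / 2) * (d : ℝ) ^ (δ / 2) := by
          refine le_mul_of_one_le_left (by positivity) (Real.one_le_rpow h1 (by positivity))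
      _ = (50 * ε * d) ^ δ := by
          rw [← Real.mul_rpow (by positivity) (by positivity)]
          rw [show (50 * ε) ^ 2 * (d : ℝ) * d = (50 * ε * d) ^ 2 by ring]
          rw [← Real.rpow_natCast, ← Real.rpow_mul (by positivity)]
          congr 1; push_cast; ring
      _ ≤ (d' : ℝ) ^ δ := Real.rpow_le_rpow (by positivity) hd' hδ.le
  by_cases hcase : (d : ℝ) ≤ ε * Real.log n
  · -- engine range directly; `d^{δ/2} ≤ d^δ` for `d ≥ 1`
    have h := H F n d hd₀d (hF d le_rfl) hcase s hmem
    refine le_trans (Real.rpow_le_rpow_of_exponent_le hn1 ?_) h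
    exact Real.rpow_le_rpow_of_exponent_le hdR (by linarith)
  · push Not at hcase
    set d' := ⌊ε * Real.log n⌋₊ with hd'
    have hlog0 : 0 ≤ ε * Real.log n := by
      have : 0 ≤ Real.log n := Real.log_nonneg hn1
      positivity
    have hd'le : (d' : ℝ) ≤ ε * Real.log n := Nat.floor_le hlog0
    have hd'ge : ε * Real.log n - 1 ≤ d' := by
      have := Nat.lt_floor_add_one (ε * Real.log n); linarith
    have hlogd : 100 * (d : ℝ) ≤ Real.log n := by
      rw [le_div_iff₀ (by norm_num)] at hdn; linarith
    have h50 : 50 * ε * d ≤ (d' : ℝ) := by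
      -- `d' ≥ 100 ε d - 1 ≥ 50 ε d` as `50 ε d ≥ 1`
      have h1 : (1 : ℝ) ≤ 50 * ε * d := by
        rw [div_le_iff₀ hε50] at hT1
        nlinarith
      nlinarith
    have hd'd : d' ≤ d := by
      have : (d' : ℝ) ≤ d := by linarith
      exact_mod_cast this
    have hd₀d' : d₀ ≤ d' := by
      have : (d₀ : ℝ) + 1 ≤ 50 * ε * d := by
        rw [div_le_iff₀ hε50] at hT1; nlinarith
      have : (d₀ : ℝ) ≤ d' := by linarith
      exact_mod_cast this
    have hmem' := BorderLST.immMatrix_mem_borderClass_of_le hd'd 0 0 hmem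
    have h := H F n d' hd₀d' (hF d' hd'd) hd'le s hmem'
    refine le_trans ?_ h
    exact Real.rpow_le_rpow_of_exponent_le hn1 (hexp d' h50)


end Literature.Computability.AlgebraicComplexity
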